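import Summits.QuantumFields.YangMills.Theorems.SwapVirialDeficitSwapGluedStiffnessOfSharpSectorLaplace
import HarnessLib

/-!
# LOCALIZED two-sided Laplace laws ⟹ window stiffness: per-REGION free constants
# (LEAD ym-line-sfw-p2 g98, free hands; cell ym-idea-1; `--supports stmt-QuantumFields-24197`; architecture memo
# `sfw-p2-g98-memo5-24197-localize-two-sided-law.md`)

WHY THIS FILE.  The socket of record for ⟨24197⟩ is ✓`SwapRing.swapGluedStiffness_of_twoSectorStiffness` (w2 g57): per even sector `z` and on a window,
`(TS)_z : κ·∫ e^{−βF_z} dμ_L ≤ β·∫ F_z e^{−βF_z} dμ_L` with `κ = 9L⁴ − 3/2 + c`.  This inequality is LINEAR IN THE MEASURE.  So instead of ONE two-sided law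
`|log Ẑ_z(b) + e_z log b − C_z| ≤ E` for the whole sector (which forces tip∕end SHARE estimates relative to the full Morse–Bott constant and hence a one-loop
determinant UNIFORMITY statement across the flat bottom), it suffices to cut the measure into finitely many REGIONS `R_i`, prove on each region its own
two-sided law with ITS OWN free constant `C_i`, turn each into `κ·Z_i ≤ b·E_i` by LEAD g97's ✓`stiffness_of_twoSided_logLaplace` (normalised to the region),
and ADD; outside the regions one only needs `βF ≥ κ` pointwise.  No constant is ever compared across regions.

* §1 ★ `stiffness_of_twoSided_logLaplace_finite` — ✓`stiffness_of_twoSided_logLaplace` for a finite non-zero measure (normalise to a probability measure;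
  the normalisation shifts both sides of the law by the same `log ν(X)`); ★ `setStiffness_of_twoSided_logLaplace` — the same on a measurable set `R` of
  positive finite measure (`μ.restrict R`); ★ `weightStiffness_of_twoSided_logLaplace` — the same for a weight `0 ≤ χ ≤ 1` (the measure `χ·μ`).
* §2 ★★ `stiffness_of_regions` — finitely many pairwise disjoint measurable regions with `κ·∫_{R_i} e^{−bF} ≤ b·∫_{R_i} F e^{−bF}` each, and `κ ≤ bF` off their
  union ⟹ `κ·∫ e^{−bF} dμ ≤ b·∫ F e^{−bF} dμ`; ★★ `stiffness_of_weights` — the same with a measurable sub-partition of unity `χ_i ≥ 0`, `Σχ_i ≤ 1`, `Σχ_i = 1` on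
  `{bF < κ}` (recommended form: no boundary layers between charts).
* §3 ★★★ `stiffness_of_local_twoSided_laws` — §1 + §2: per-region two-sided laws `−e_i log b + C_i − E₁ ≤ log ∫_{R_i}e^{−bF}`,
  `log ∫_{R_i}e^{−(1+h)bF} ≤ −e_i log((1+h)b) + C_i + E₂`, `κ ≤ e_i/(1+h) − (E₁+E₂)/h`, and `κ ≤ bF` off `⋃R_i` ⟹ `κ·∫e^{−bF} ≤ b·∫F e^{−bF}`.
  ★★★ `stiffness_of_local_twoSided_laws_weights` — the partition-of-unity form.
  Instantiated with `μ` = the chart-side measure of sector `z`, `F = F̂_z`, `κ = 9L⁴ − 3/2 + c`, `h = 1/(40L⁴)`, this is `(TS)_z` from REGION-LOCAL Morse–Bott data.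
* §4 ★★ `stiffness_of_regions_and_core` — regions stiff with a SURPLUS `s`, plus a CORE (apex ∕ branch-crossing neighbourhood, typically `b`-dependent) that is
  never given a law: it only needs `κ·Z_core ≤ s·Σ_i Z_{R_i}`.

HONEST LABEL: elementary measure theory (a reduction); every region's two-sided law is model-side and OPEN; ⟨24197⟩ ∕ ⟨24194⟩ OPEN; ⟨24196⟩ proved elsewhere; own crux
⟨22884⟩ OPEN (blocked-on ⟨19935⟩); no rung of record or summit is proved; the Yang–Mills mass gap is NOT proved; no summit is proved by a line.  THEOREMS ONLY
(hypotheses inline; 0 `def`, 0 `sorry`), standard axioms.  References: [cite: Griffiths1964]; [folklore].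
-/

set_option autoImplicit false

noncomputable section

open MeasureTheory Set Filter Function
open scoped BigOperators Topology ENNReal

namespace Summit.QuantumFields.YangMills.Theorems.SwapVirialDeficit.SwapRing

section Local

variable {X : Type*} [MeasurableSpace X]

/-! ## §1 The two-sided law ⟹ stiffness, on a finite measure and on a region -/

/-- `e^{tF}`-type integrands are integrable on a finite measure when `|F| ≤ M`. [folklore] -/
theorem integrable_exp_neg_mul_of_bound (ν : Measure X) [IsFiniteMeasure ν] {F : X → ℝ} {M : ℝ} (hF : Measurable F)
    (hbd : ∀ x, |F x| ≤ M) (t : ℝ) : Integrable (fun x => Real.exp (-t * F x)) ν := by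
  refine Integrable.mono' (integrable_const (Real.exp (|t| * M))) ((hF.const_mul (-t)).exp.aestronglyMeasurable) ?_
  refine Eventually.of_forall fun x => ?_
  rw [Real.norm_eq_abs, abs_of_pos (Real.exp_pos _)]
  refine Real.exp_le_exp.2 ?_
  calc -t * F x ≤ |-t * F x| := le_abs_self _
    _ = |t| * |F x| := by rw [abs_mul, abs_neg]
    _ ≤ |t| * M := mul_le_mul_of_nonneg_left (hbd x) (abs_nonneg _)

/-- `F·e^{−tF}` is integrable on a finite measure when `|F| ≤ M`. [folklore] -/
theorem integrable_mul_exp_neg_mul_of_bound (ν : Measure X) [IsFiniteMeasure ν] {F : X → ℝ} {M : ℝ} (hF : Measurable F)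
    (hbd : ∀ x, |F x| ≤ M) (t : ℝ) : Integrable (fun x => F x * Real.exp (-t * F x)) ν := by
  refine Integrable.mono' (integrable_const (M * Real.exp (|t| * M))) (hF.mul (hF.const_mul (-t)).exp).aestronglyMeasurable ?_
  refine Eventually.of_forall fun x => ?_
  rw [Real.norm_eq_abs, abs_mul, abs_of_pos (Real.exp_pos _)]
  refine mul_le_mul (hbd x) (Real.exp_le_exp.2 ?_) (Real.exp_pos _).le ((abs_nonneg _).trans (hbd x))
  calc -t * F x ≤ |-t * F x| := le_abs_self _
    _ = |t| * |F x| := by rw [abs_mul, abs_neg]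
    _ ≤ |t| * M := mul_le_mul_of_nonneg_left (hbd x) (abs_nonneg _)

/-- ★ **STIFFNESS FROM A TWO-SIDED LOG-LAPLACE LAW, FINITE-MEASURE VERSION**: `ν` finite and non-zero, `F` bounded measurable, `b > 0`, `h > 0`, `e ≥ 0`;
if `log Z(b) ≥ −e log b + C − E₁` and `log Z((1+h)b) ≤ −e log((1+h)b) + C + E₂` (`Z(t) = ∫e^{−tF}dν`, the SAME `C`) then
`(e/(1+h) − (E₁+E₂)/h)·Z(b) ≤ b·∫F e^{−bF}dν` (✓`stiffness_of_twoSided_logLaplace` on the normalised measure; the normalisation shifts `C`). [cite: Griffiths1964] -/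
theorem stiffness_of_twoSided_logLaplace_finite (ν : Measure X) [IsFiniteMeasure ν] [NeZero ν] {F : X → ℝ} {M : ℝ}
    (hF : Measurable F) (hbd : ∀ x, |F x| ≤ M) {b h e C E₁ E₂ : ℝ} (hb : 0 < b) (hh : 0 < h) (he : 0 ≤ e)
    (hlow : -e * Real.log b + C - E₁ ≤ Real.log (∫ x, Real.exp (-b * F x) ∂ν))
    (hup : Real.log (∫ x, Real.exp (-((1 + h) * b) * F x) ∂ν) ≤ -e * Real.log ((1 + h) * b) + C + E₂) :
    (e / (1 + h) - (E₁ + E₂) / h) * ∫ x, Real.exp (-b * F x) ∂ν ≤ b * ∫ x, F x * Real.exp (-b * F x) ∂ν := by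
  -- the total mass and the normalised probability measure
  have hν0 : ν univ ≠ 0 := by
    intro h0; exact (NeZero.ne ν) (Measure.measure_univ_eq_zero.1 h0)
  have hνtop : ν univ ≠ ∞ := measure_ne_top ν univ
  set m : ℝ := (ν univ).toReal with hm_def
  have hm : 0 < m := ENNReal.toReal_pos hν0 hνtop
  set μ : Measure X := (ν univ)⁻¹ • ν with hμ_def
  haveI : IsProbabilityMeasure μ := by
    refine ⟨?_⟩
    rw [hμ_def, Measure.smul_apply, smul_eq_mul, ENNReal.inv_mul_cancel hν0 hνtop]
  have hint : ∀ g : X → ℝ, ∫ x, g x ∂μ = m⁻¹ * ∫ x, g x ∂ν := fun g => by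
    rw [hμ_def, integral_smul_measure, ENNReal.toReal_inv, smul_eq_mul]
  -- positivity of the two partition functions on `ν`
  have hZpos : ∀ t : ℝ, 0 < ∫ x, Real.exp (-t * F x) ∂ν := fun t =>
    integral_exp_pos (integrable_exp_neg_mul_of_bound ν hF hbd t)
  -- the normalised laws: `log Z_μ = log Z_ν − log m`
  have hlog : ∀ t : ℝ, Real.log (∫ x, Real.exp (-t * F x) ∂μ) = Real.log (∫ x, Real.exp (-t * F x) ∂ν) - Real.log m := fun t => by
    rw [hint, Real.log_mul (inv_pos.2 hm).ne' (hZpos t).ne', Real.log_inv]; ring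
  have hlow' : -e * Real.log b + (C - Real.log m) - E₁ ≤ Real.log (∫ x, Real.exp (-b * F x) ∂μ) := by
    rw [hlog]; linarith
  have hup' : Real.log (∫ x, Real.exp (-((1 + h) * b) * F x) ∂μ) ≤ -e * Real.log ((1 + h) * b) + (C - Real.log m) + E₂ := by
    rw [hlog]; linarith
  have key := stiffness_of_twoSided_logLaplace μ hF hbd hb hh he hlow' hup'
  rw [hint (fun x => Real.exp (-b * F x)), hint (fun x => F x * Real.exp (-b * F x))] at key
  -- undo the normalisation
  have key' := mul_le_mul_of_nonneg_left key hm.le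
  have e1 : m * ((e / (1 + h) - (E₁ + E₂) / h) * (m⁻¹ * ∫ x, Real.exp (-b * F x) ∂ν)) =
      (e / (1 + h) - (E₁ + E₂) / h) * ∫ x, Real.exp (-b * F x) ∂ν := by
    field_simp
  have e2 : m * (b * (m⁻¹ * ∫ x, F x * Real.exp (-b * F x) ∂ν)) = b * ∫ x, F x * Real.exp (-b * F x) ∂ν := by
    field_simp
  rw [e1, e2] at key'
  exact key'

/-- ★ **THE SAME ON A REGION**: `R` measurable with `0 < μ R < ∞`; a two-sided law for `∫_R e^{−tF}dμ` at `t = b` (lower) and `t = (1+h)b` (upper) with a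
common constant gives `(e/(1+h) − (E₁+E₂)/h)·∫_R e^{−bF} ≤ b·∫_R F e^{−bF}`. [cite: Griffiths1964] -/
theorem setStiffness_of_twoSided_logLaplace (μ : Measure X) {R : Set X} (hRpos : μ R ≠ 0) (hRfin : μ R ≠ ∞) {F : X → ℝ} {M : ℝ}
    (hF : Measurable F) (hbd : ∀ x, |F x| ≤ M) {b h e C E₁ E₂ : ℝ} (hb : 0 < b) (hh : 0 < h) (he : 0 ≤ e)
    (hlow : -e * Real.log b + C - E₁ ≤ Real.log (∫ x in R, Real.exp (-b * F x) ∂μ))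
    (hup : Real.log (∫ x in R, Real.exp (-((1 + h) * b) * F x) ∂μ) ≤ -e * Real.log ((1 + h) * b) + C + E₂) :
    (e / (1 + h) - (E₁ + E₂) / h) * ∫ x in R, Real.exp (-b * F x) ∂μ ≤ b * ∫ x in R, F x * Real.exp (-b * F x) ∂μ := by
  haveI : IsFiniteMeasure (μ.restrict R) := ⟨by rwa [Measure.restrict_apply_univ, lt_top_iff_ne_top]⟩
  haveI : NeZero (μ.restrict R) := ⟨by
    intro h0
    have : μ.restrict R univ = 0 := by rw [h0]; rfl
    rw [Measure.restrict_apply_univ] at this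
    exact hRpos this⟩
  exact stiffness_of_twoSided_logLaplace_finite (μ.restrict R) hF hbd hb hh he hlow hup


/-- ★ **THE SAME FOR A WEIGHT**: `0 ≤ χ ≤ 1` measurable on a finite measure `μ`; a two-sided law for `∫ χ·e^{−tF}dμ` at `t = b` (lower) and `t = (1+h)b`
(upper) with a common constant gives `(e/(1+h) − (E₁+E₂)/h)·∫χ e^{−bF} ≤ b·∫χ·F e^{−bF}` (the measure `χ·μ`). [cite: Griffiths1964] -/
theorem weightStiffness_of_twoSided_logLaplace (μ : Measure X) [IsFiniteMeasure μ] {χ : X → ℝ} (hχm : Measurable χ) (hχ0 : ∀ x, 0 ≤ χ x)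
    (hχ1 : ∀ x, χ x ≤ 1) {F : X → ℝ} {M : ℝ} (hF : Measurable F) (hbd : ∀ x, |F x| ≤ M) {b h e C E₁ E₂ : ℝ} (hb : 0 < b) (hh : 0 < h)
    (he : 0 ≤ e) (hpos : 0 < ∫ x, χ x * Real.exp (-b * F x) ∂μ)
    (hlow : -e * Real.log b + C - E₁ ≤ Real.log (∫ x, χ x * Real.exp (-b * F x) ∂μ))
    (hup : Real.log (∫ x, χ x * Real.exp (-((1 + h) * b) * F x) ∂μ) ≤ -e * Real.log ((1 + h) * b) + C + E₂) :
    (e / (1 + h) - (E₁ + E₂) / h) * ∫ x, χ x * Real.exp (-b * F x) ∂μ ≤ b * ∫ x, χ x * (F x * Real.exp (-b * F x)) ∂μ := by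
  -- the weighted measure `ν = χ·μ`
  set ν : Measure X := μ.withDensity (fun x => ENNReal.ofReal (χ x)) with hν_def
  have hdm : Measurable fun x => ENNReal.ofReal (χ x) := ENNReal.measurable_ofReal.comp hχm
  have hint : ∀ g : X → ℝ, ∫ x, g x ∂ν = ∫ x, χ x * g x ∂μ := fun g => by
    rw [hν_def, integral_withDensity_eq_integral_toReal_smul hdm (Eventually.of_forall fun x => ENNReal.ofReal_lt_top) g]
    exact integral_congr_ae (Eventually.of_forall fun x => by simp only [ENNReal.toReal_ofReal (hχ0 x), smul_eq_mul])
  haveI : IsFiniteMeasure ν := by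
    refine ⟨?_⟩
    rw [hν_def, withDensity_apply _ MeasurableSet.univ, Measure.restrict_univ]
    calc ∫⁻ x, ENNReal.ofReal (χ x) ∂μ ≤ ∫⁻ _x, 1 ∂μ := lintegral_mono fun x => by
            rw [← ENNReal.ofReal_one]; exact ENNReal.ofReal_le_ofReal (hχ1 x)
      _ < ∞ := by rw [lintegral_const, one_mul]; exact measure_lt_top μ univ
  haveI : NeZero ν := ⟨by
    intro h0
    have h1 : ∫ x, Real.exp (-b * F x) ∂ν = 0 := by rw [h0, integral_zero_measure]
    rw [hint] at h1
    linarith⟩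
  have key := stiffness_of_twoSided_logLaplace_finite ν hF hbd hb hh he (C := C) (E₁ := E₁) (E₂ := E₂)
    (by rw [hint]; exact hlow) (by rw [hint]; exact hup)
  rw [hint, hint] at key
  exact key

/-! ## §2 Additivity: regions (or weights) with local stiffness, and `βF ≥ κ` elsewhere -/

/-- ★★ **STIFFNESS FROM REGIONS**: `μ` finite, `F` bounded measurable, `b, κ` real; finitely many pairwise disjoint measurable regions `R_i` on each of which
`κ·∫_{R_i}e^{−bF} ≤ b·∫_{R_i}F e^{−bF}`, and `κ ≤ b·F` pointwise off `⋃ R_i`.  Then `κ·∫e^{−bF}dμ ≤ b·∫F e^{−bF}dμ` — the per-sector window stiffness `(TS)` of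
✓`swapGluedStiffness_of_twoSectorStiffness` is ADDITIVE in the measure. [folklore] -/
theorem stiffness_of_regions (μ : Measure X) [IsFiniteMeasure μ] {F : X → ℝ} {M : ℝ} (hF : Measurable F) (hbd : ∀ x, |F x| ≤ M)
    {ι : Type*} (s : Finset ι) (R : ι → Set X) (hR : ∀ i ∈ s, MeasurableSet (R i)) (hdisj : (s : Set ι).Pairwise (Disjoint on R))
    {b κ : ℝ}
    (hloc : ∀ i ∈ s, κ * ∫ x in R i, Real.exp (-b * F x) ∂μ ≤ b * ∫ x in R i, F x * Real.exp (-b * F x) ∂μ)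
    (hfar : ∀ x, x ∉ (⋃ i ∈ s, R i) → κ ≤ b * F x) :
    κ * ∫ x, Real.exp (-b * F x) ∂μ ≤ b * ∫ x, F x * Real.exp (-b * F x) ∂μ := by
  -- the signed integrand `g = (bF − κ)e^{−bF}`
  set g : X → ℝ := fun x => (b * F x - κ) * Real.exp (-b * F x) with hg_def
  have hZ := integrable_exp_neg_mul_of_bound μ hF hbd b
  have hE := integrable_mul_exp_neg_mul_of_bound μ hF hbd b
  have hg : Integrable g μ := by
    have h1 : Integrable (fun x => b * (F x * Real.exp (-b * F x)) - κ * Real.exp (-b * F x)) μ := (hE.const_mul b).sub (hZ.const_mul κ)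
    refine h1.congr (Eventually.of_forall fun x => ?_)
    simp only [hg_def]; ring
  have hg_int : ∀ (A : Set X), ∫ x in A, g x ∂μ = b * ∫ x in A, F x * Real.exp (-b * F x) ∂μ - κ * ∫ x in A, Real.exp (-b * F x) ∂μ := by
    intro A
    have e1 : ∫ x in A, g x ∂μ = ∫ x in A, (b * (F x * Real.exp (-b * F x)) - κ * Real.exp (-b * F x)) ∂μ :=
      integral_congr_ae (Eventually.of_forall fun x => by simp only [hg_def]; ring)
    rw [e1, integral_sub (hE.const_mul b).integrableOn (hZ.const_mul κ).integrableOn, integral_const_mul, integral_const_mul]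
  -- it suffices that `∫ g ≥ 0`
  suffices h0 : 0 ≤ ∫ x, g x ∂μ by
    have e1 : ∫ x, g x ∂μ = b * ∫ x, F x * Real.exp (-b * F x) ∂μ - κ * ∫ x, Real.exp (-b * F x) ∂μ := by
      have := hg_int univ
      simp only [Measure.restrict_univ] at this
      exact this
    linarith [e1 ▸ h0]
  -- split into the union of the regions and its complement
  set U : Set X := ⋃ i ∈ s, R i with hU_def
  have hU : MeasurableSet U := Finset.measurableSet_biUnion s hR
  rw [← integral_add_compl hU hg]
  refine add_nonneg ?_ ?_
  · -- on the union: the sum of the regional surpluses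
    rw [hU_def, integral_biUnion_finset s hR hdisj (fun i _ => hg.integrableOn)]
    refine Finset.sum_nonneg fun i hi => ?_
    rw [hg_int]
    linarith [hloc i hi]
  · -- off the union: the integrand is pointwise non-negative
    refine setIntegral_nonneg hU.compl fun x hx => ?_
    have hx' : x ∉ U := hx
    have h1 := hfar x (by rw [hU_def] at hx'; exact hx')
    exact mul_nonneg (by linarith) (Real.exp_pos _).le

/-- ★★ **STIFFNESS FROM WEIGHTS** (sub-partition of unity — no boundary layers): `μ` finite, `F` bounded measurable, `b, κ` real; finitely many measurable weights
`0 ≤ χ_i` with `Σ_i χ_i ≤ 1` everywhere and `Σ_i χ_i = 1` wherever `b·F < κ`; if `κ·∫χ_i e^{−bF} ≤ b·∫χ_i F e^{−bF}` for each `i`, then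
`κ·∫e^{−bF}dμ ≤ b·∫F e^{−bF}dμ`. [folklore] -/
theorem stiffness_of_weights (μ : Measure X) [IsFiniteMeasure μ] {F : X → ℝ} {M : ℝ} (hF : Measurable F) (hbd : ∀ x, |F x| ≤ M)
    {ι : Type*} (s : Finset ι) (χ : ι → X → ℝ) (hχm : ∀ i ∈ s, Measurable (χ i)) (hχ0 : ∀ i ∈ s, ∀ x, 0 ≤ χ i x)
    (hχ1 : ∀ x, ∑ i ∈ s, χ i x ≤ 1) {b κ : ℝ} (hχcov : ∀ x, b * F x < κ → ∑ i ∈ s, χ i x = 1)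
    (hloc : ∀ i ∈ s, κ * ∫ x, χ i x * Real.exp (-b * F x) ∂μ ≤ b * ∫ x, χ i x * (F x * Real.exp (-b * F x)) ∂μ) :
    κ * ∫ x, Real.exp (-b * F x) ∂μ ≤ b * ∫ x, F x * Real.exp (-b * F x) ∂μ := by
  set g : X → ℝ := fun x => (b * F x - κ) * Real.exp (-b * F x) with hg_def
  have hZ := integrable_exp_neg_mul_of_bound μ hF hbd b
  have hE := integrable_mul_exp_neg_mul_of_bound μ hF hbd b
  have hg : Integrable g μ := by
    have h1 : Integrable (fun x => b * (F x * Real.exp (-b * F x)) - κ * Real.exp (-b * F x)) μ := (hE.const_mul b).sub (hZ.const_mul κ)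
    refine h1.congr (Eventually.of_forall fun x => ?_)
    simp only [hg_def]; ring
  -- bounded weights: `0 ≤ χ_i ≤ 1`
  have hχle1 : ∀ i ∈ s, ∀ x, χ i x ≤ 1 := fun i hi x =>
    (Finset.single_le_sum (fun j hj => hχ0 j hj x) hi).trans (hχ1 x)
  have hχg : ∀ i ∈ s, Integrable (fun x => χ i x * g x) μ := fun i hi =>
    Integrable.bdd_mul (c := 1) hg (hχm i hi).aestronglyMeasurable
      (Eventually.of_forall fun x => by rw [Real.norm_eq_abs, abs_of_nonneg (hχ0 i hi x)]; exact hχle1 i hi x)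
  -- `∫ g = ∫ (Σχ_i) g + ∫ (1 − Σχ_i) g`, both non-negative
  suffices h0 : 0 ≤ ∫ x, g x ∂μ by
    have e1 : ∫ x, g x ∂μ = b * ∫ x, F x * Real.exp (-b * F x) ∂μ - κ * ∫ x, Real.exp (-b * F x) ∂μ := by
      have e0 : ∫ x, g x ∂μ = ∫ x, (b * (F x * Real.exp (-b * F x)) - κ * Real.exp (-b * F x)) ∂μ :=
        integral_congr_ae (Eventually.of_forall fun x => by simp only [hg_def]; ring)
      rw [e0, integral_sub (hE.const_mul b) (hZ.const_mul κ), integral_const_mul, integral_const_mul]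
    linarith [e1 ▸ h0]
  have hsum : Integrable (fun x => (∑ i ∈ s, χ i x) * g x) μ := by
    have : Integrable (fun x => ∑ i ∈ s, χ i x * g x) μ := integrable_finsetSum s fun i hi => hχg i hi
    exact this.congr (Eventually.of_forall fun x => by simp only [Finset.sum_mul])
  have hrest : Integrable (fun x => (1 - ∑ i ∈ s, χ i x) * g x) μ := by
    have : Integrable (fun x => g x - (∑ i ∈ s, χ i x) * g x) μ := hg.sub hsum
    exact this.congr (Eventually.of_forall fun x => by ring)
  have esplit : ∫ x, g x ∂μ = (∫ x, (∑ i ∈ s, χ i x) * g x ∂μ) + ∫ x, (1 - ∑ i ∈ s, χ i x) * g x ∂μ := by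
    rw [← integral_add hsum hrest]
    exact integral_congr_ae (Eventually.of_forall fun x => by ring)
  rw [esplit]
  refine add_nonneg ?_ ?_
  · -- the weighted sum of the local surpluses
    have e1 : ∫ x, (∑ i ∈ s, χ i x) * g x ∂μ = ∑ i ∈ s, ∫ x, χ i x * g x ∂μ := by
      rw [← integral_finsetSum s fun i hi => hχg i hi]
      exact integral_congr_ae (Eventually.of_forall fun x => by simp only [Finset.sum_mul])
    rw [e1]
    refine Finset.sum_nonneg fun i hi => ?_
    have e2 : ∫ x, χ i x * g x ∂μ = b * ∫ x, χ i x * (F x * Real.exp (-b * F x)) ∂μ - κ * ∫ x, χ i x * Real.exp (-b * F x) ∂μ := by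
      have hA : Integrable (fun x => χ i x * (F x * Real.exp (-b * F x))) μ :=
        Integrable.bdd_mul (c := 1) hE (hχm i hi).aestronglyMeasurable
          (Eventually.of_forall fun x => by rw [Real.norm_eq_abs, abs_of_nonneg (hχ0 i hi x)]; exact hχle1 i hi x)
      have hB : Integrable (fun x => χ i x * Real.exp (-b * F x)) μ :=
        Integrable.bdd_mul (c := 1) hZ (hχm i hi).aestronglyMeasurable
          (Eventually.of_forall fun x => by rw [Real.norm_eq_abs, abs_of_nonneg (hχ0 i hi x)]; exact hχle1 i hi x)
      rw [← integral_const_mul, ← integral_const_mul, ← integral_sub (hA.const_mul b) (hB.const_mul κ)]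
      exact integral_congr_ae (Eventually.of_forall fun x => by simp only [hg_def]; ring)
    rw [e2]
    linarith [hloc i hi]
  · -- the uncovered weight sits where `bF ≥ κ`
    refine integral_nonneg fun x => ?_
    simp only [Pi.zero_apply]
    by_cases hlt : b * F x < κ
    · rw [hχcov x hlt, sub_self, zero_mul]
    · exact mul_nonneg (by linarith [hχ1 x]) (mul_nonneg (by linarith) (Real.exp_pos _).le)

/-! ## §3 The assembly: region-local two-sided laws ⟹ window stiffness -/

/-- ★★★ **WINDOW STIFFNESS FROM REGION-LOCAL TWO-SIDED LAPLACE LAWS** (memo5: per-region FREE constants `C_i`; no uniformity across the bottom):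
`μ` finite, `F` bounded measurable, `b > 0`, step `h > 0`; finitely many pairwise disjoint measurable regions `R_i` of positive measure, each with an exponent
`e_i ≥ 0`, a constant `C_i` and a two-sided law — LOWER at `b`: `−e_i log b + C_i − E₁ ≤ log ∫_{R_i}e^{−bF}`, UPPER at `(1+h)b`:
`log ∫_{R_i}e^{−(1+h)bF} ≤ −e_i log((1+h)b) + C_i + E₂` — and `κ ≤ e_i/(1+h) − (E₁+E₂)/h` for every `i`; off `⋃R_i`, `κ ≤ b·F` pointwise.
Then `κ·∫e^{−bF}dμ ≤ b·∫F e^{−bF}dμ`.  (With `e_i ≥ 9L⁴ − 1`, `h = 1/(40L⁴)`: `E₁ + E₂ ≤ (11/40 − c)/(40L⁴)` gives `κ = 9L⁴ − 3/2 + c`.) [cite: Griffiths1964] [folklore] -/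
theorem stiffness_of_local_twoSided_laws (μ : Measure X) [IsFiniteMeasure μ] {F : X → ℝ} {M : ℝ} (hF : Measurable F) (hbd : ∀ x, |F x| ≤ M)
    {ι : Type*} (s : Finset ι) (R : ι → Set X) (hR : ∀ i ∈ s, MeasurableSet (R i)) (hdisj : (s : Set ι).Pairwise (Disjoint on R))
    (hRpos : ∀ i ∈ s, μ (R i) ≠ 0) {b h κ E₁ E₂ : ℝ} (hb : 0 < b) (hh : 0 < h) (e C : ι → ℝ) (he : ∀ i ∈ s, 0 ≤ e i)
    (hlow : ∀ i ∈ s, -(e i) * Real.log b + C i - E₁ ≤ Real.log (∫ x in R i, Real.exp (-b * F x) ∂μ))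
    (hup : ∀ i ∈ s, Real.log (∫ x in R i, Real.exp (-((1 + h) * b) * F x) ∂μ) ≤ -(e i) * Real.log ((1 + h) * b) + C i + E₂)
    (hκ : ∀ i ∈ s, κ ≤ e i / (1 + h) - (E₁ + E₂) / h)
    (hfar : ∀ x, x ∉ (⋃ i ∈ s, R i) → κ ≤ b * F x) :
    κ * ∫ x, Real.exp (-b * F x) ∂μ ≤ b * ∫ x, F x * Real.exp (-b * F x) ∂μ := by
  refine stiffness_of_regions μ hF hbd s R hR hdisj (fun i hi => ?_) hfar
  have hloc := setStiffness_of_twoSided_logLaplace μ (hRpos i hi) (measure_ne_top μ (R i)) hF hbd hb hh (he i hi) (hlow i hi) (hup i hi)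
  have hZ0 : 0 ≤ ∫ x in R i, Real.exp (-b * F x) ∂μ := integral_nonneg fun x => (Real.exp_pos _).le
  exact (mul_le_mul_of_nonneg_right (hκ i hi) hZ0).trans hloc


/-- ★★★ **WINDOW STIFFNESS FROM WEIGHT-LOCAL TWO-SIDED LAPLACE LAWS** (partition-of-unity form): `μ` finite, `F` bounded measurable, `b > 0`, `h > 0`;
finitely many measurable weights `0 ≤ χ_i`, `Σχ_i ≤ 1`, `Σχ_i = 1` on `{bF < κ}`, each with `∫χ_i e^{−bF} > 0`, an exponent `e_i ≥ 0`, a constant `C_i` and a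
two-sided law (lower at `b`, upper at `(1+h)b`, the SAME `C_i`), and `κ ≤ e_i/(1+h) − (E₁+E₂)/h`.  Then `κ·∫e^{−bF}dμ ≤ b·∫F e^{−bF}dμ`. [cite: Griffiths1964] [folklore] -/
theorem stiffness_of_local_twoSided_laws_weights (μ : Measure X) [IsFiniteMeasure μ] {F : X → ℝ} {M : ℝ} (hF : Measurable F)
    (hbd : ∀ x, |F x| ≤ M) {ι : Type*} (s : Finset ι) (χ : ι → X → ℝ) (hχm : ∀ i ∈ s, Measurable (χ i))
    (hχ0 : ∀ i ∈ s, ∀ x, 0 ≤ χ i x) (hχ1 : ∀ x, ∑ i ∈ s, χ i x ≤ 1) {b h κ E₁ E₂ : ℝ} (hb : 0 < b) (hh : 0 < h)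
    (hχcov : ∀ x, b * F x < κ → ∑ i ∈ s, χ i x = 1) (e C : ι → ℝ) (he : ∀ i ∈ s, 0 ≤ e i)
    (hpos : ∀ i ∈ s, 0 < ∫ x, χ i x * Real.exp (-b * F x) ∂μ)
    (hlow : ∀ i ∈ s, -(e i) * Real.log b + C i - E₁ ≤ Real.log (∫ x, χ i x * Real.exp (-b * F x) ∂μ))
    (hup : ∀ i ∈ s, Real.log (∫ x, χ i x * Real.exp (-((1 + h) * b) * F x) ∂μ) ≤ -(e i) * Real.log ((1 + h) * b) + C i + E₂)
    (hκ : ∀ i ∈ s, κ ≤ e i / (1 + h) - (E₁ + E₂) / h) :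
    κ * ∫ x, Real.exp (-b * F x) ∂μ ≤ b * ∫ x, F x * Real.exp (-b * F x) ∂μ := by
  have hχle1 : ∀ i ∈ s, ∀ x, χ i x ≤ 1 := fun i hi x =>
    (Finset.single_le_sum (fun j hj => hχ0 j hj x) hi).trans (hχ1 x)
  refine stiffness_of_weights μ hF hbd s χ hχm hχ0 hχ1 hχcov fun i hi => ?_
  have hloc := weightStiffness_of_twoSided_logLaplace μ (hχm i hi) (hχ0 i hi) (hχle1 i hi) hF hbd hb hh (he i hi) (hpos i hi)
    (hlow i hi) (hup i hi)
  have hZ0 : 0 ≤ ∫ x, χ i x * Real.exp (-b * F x) ∂μ := integral_nonneg fun x => mul_nonneg (hχ0 i hi x) (Real.exp_pos _).le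
  exact (mul_le_mul_of_nonneg_right (hκ i hi) hZ0).trans hloc


/-! ## §4 Regions with a merged CORE (apex ∕ branch crossing): the core only needs to be small relative to the regions' surplus -/

/-- ★★ **STIFFNESS FROM REGIONS WITH SURPLUS AND A MERGED CORE** (memo5 §2 (Rc)∕(Rd)): `μ` finite, `F ≥ 0` bounded measurable, `b > 0`; pairwise disjoint
measurable regions `R_i` each stiff with a SURPLUS `s ≥ 0`: `(κ + s)·∫_{R_i}e^{−bF} ≤ b·∫_{R_i}F e^{−bF}`; a measurable CORE `N`, disjoint from the regions, whose
weight is small against that surplus: `κ·∫_N e^{−bF} ≤ s·Σ_i ∫_{R_i} e^{−bF}`; and `κ ≤ b·F` off `N ∪ ⋃R_i`.  Then `κ·∫e^{−bF}dμ ≤ b·∫F e^{−bF}dμ` — the core never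
gets a Laplace law of its own (with `κ ≍ 9L⁴`, `s ≍ 1/8` the core must carry `≲ Σ_i Z_i/(72L⁴)`, a power of `b` to spare in the applications). [folklore] -/
theorem stiffness_of_regions_and_core (μ : Measure X) [IsFiniteMeasure μ] {F : X → ℝ} {M : ℝ} (hF : Measurable F) (hbd : ∀ x, |F x| ≤ M)
    (hF0 : ∀ x, 0 ≤ F x) {ι : Type*} (s : Finset ι) (R : ι → Set X) (hR : ∀ i ∈ s, MeasurableSet (R i))
    (hdisj : (s : Set ι).Pairwise (Disjoint on R)) {N : Set X} (hN : MeasurableSet N) (hNdisj : ∀ i ∈ s, Disjoint N (R i))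
    {b κ sur : ℝ} (hb : 0 < b)
    (hloc : ∀ i ∈ s, (κ + sur) * ∫ x in R i, Real.exp (-b * F x) ∂μ ≤ b * ∫ x in R i, F x * Real.exp (-b * F x) ∂μ)
    (hcore : κ * ∫ x in N, Real.exp (-b * F x) ∂μ ≤ sur * ∑ i ∈ s, ∫ x in R i, Real.exp (-b * F x) ∂μ)
    (hfar : ∀ x, x ∉ N → x ∉ (⋃ i ∈ s, R i) → κ ≤ b * F x) :
    κ * ∫ x, Real.exp (-b * F x) ∂μ ≤ b * ∫ x, F x * Real.exp (-b * F x) ∂μ := by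
  classical
  set g : X → ℝ := fun x => (b * F x - κ) * Real.exp (-b * F x) with hg_def
  have hZ := integrable_exp_neg_mul_of_bound μ hF hbd b
  have hE := integrable_mul_exp_neg_mul_of_bound μ hF hbd b
  have hg : Integrable g μ := by
    have h1 : Integrable (fun x => b * (F x * Real.exp (-b * F x)) - κ * Real.exp (-b * F x)) μ := (hE.const_mul b).sub (hZ.const_mul κ)
    refine h1.congr (Eventually.of_forall fun x => ?_)
    simp only [hg_def]; ring
  have hg_int : ∀ (A : Set X), ∫ x in A, g x ∂μ = b * ∫ x in A, F x * Real.exp (-b * F x) ∂μ - κ * ∫ x in A, Real.exp (-b * F x) ∂μ := by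
    intro A
    have e1 : ∫ x in A, g x ∂μ = ∫ x in A, (b * (F x * Real.exp (-b * F x)) - κ * Real.exp (-b * F x)) ∂μ :=
      integral_congr_ae (Eventually.of_forall fun x => by simp only [hg_def]; ring)
    rw [e1, integral_sub (hE.const_mul b).integrableOn (hZ.const_mul κ).integrableOn, integral_const_mul, integral_const_mul]
  suffices h0 : 0 ≤ ∫ x, g x ∂μ by
    have e1 : ∫ x, g x ∂μ = b * ∫ x, F x * Real.exp (-b * F x) ∂μ - κ * ∫ x, Real.exp (-b * F x) ∂μ := by
      have := hg_int univ
      simp only [Measure.restrict_univ] at this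
      exact this
    linarith [e1 ▸ h0]
  -- split `X = N ∪ U ∪ rest`, `U = ⋃ R_i`
  set U : Set X := ⋃ i ∈ s, R i with hU_def
  have hU : MeasurableSet U := Finset.measurableSet_biUnion s hR
  have hNU : Disjoint N U := by
    rw [hU_def, Set.disjoint_iUnion₂_right]
    exact fun i hi => hNdisj i hi
  rw [← integral_add_compl (hN.union hU) hg, setIntegral_union hNU hU hg.integrableOn hg.integrableOn]
  -- the regions' surplus
  have hUsum : ∫ x in U, g x ∂μ = ∑ i ∈ s, ∫ x in R i, g x ∂μ := by
    rw [hU_def, integral_biUnion_finset s hR hdisj (fun i _ => hg.integrableOn)]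
  have hregion : ∀ i ∈ s, sur * ∫ x in R i, Real.exp (-b * F x) ∂μ ≤ ∫ x in R i, g x ∂μ := fun i hi => by
    rw [hg_int]; linarith [hloc i hi]
  have hUge : sur * ∑ i ∈ s, ∫ x in R i, Real.exp (-b * F x) ∂μ ≤ ∫ x in U, g x ∂μ := by
    rw [hUsum, Finset.mul_sum]
    exact Finset.sum_le_sum hregion
  -- the core deficit: `∫_N g ≥ −κ Z_N` since `F ≥ 0`
  have hNge : -(κ * ∫ x in N, Real.exp (-b * F x) ∂μ) ≤ ∫ x in N, g x ∂μ := by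
    rw [hg_int]
    have h1 : 0 ≤ ∫ x in N, F x * Real.exp (-b * F x) ∂μ :=
      setIntegral_nonneg hN fun x _ => mul_nonneg (hF0 x) (Real.exp_pos _).le
    nlinarith [h1, hb]
  -- the rest is pointwise non-negative
  have hrest : 0 ≤ ∫ x in (N ∪ U)ᶜ, g x ∂μ := by
    refine setIntegral_nonneg (hN.union hU).compl fun x hx => ?_
    have hx' : x ∉ N ∧ x ∉ U := by simpa only [Set.mem_compl_iff, Set.mem_union, not_or] using hx
    have h1 := hfar x hx'.1 (by rw [hU_def] at hx'; exact hx'.2)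
    exact mul_nonneg (by linarith) (Real.exp_pos _).le
  linarith [hcore]

end Local

end Summit.QuantumFields.YangMills.Theorems.SwapVirialDeficit.SwapRing

end
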